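import Literature.MathematicalPhysics.QuantumManyBody.BoseGasStructureFactor
import Literature.MathematicalPhysics.QuantumManyBody.OnsagerInequality
import HarnessLib

/-!
# Stub `stub_normSqDensityWave` of crux `ModePriceIntegrable` (stmt-AtomisticToContinuum-18512), line `Sketch`

Route `BECModePrice` of `AtomisticToContinuum/BoseEinsteinCondensation`, crux `ModePriceIntegrable`
(the single-mode softening price for the dilute Bose gas), line `Sketch` (notch-the-vertex cut),
registered stub N `stub_normSqDensityWave`: the pointwise identity behind the energy bookkeeping
`E(Ψ) + tN²/L³ = F_t(Ψ) + M_t(Ψ)` of the notch. For the density wave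
`ρ_k(X) = ∑_j e^{iθ_j}` (`BoseGas.densityWave`, `k = 2πm/L`, `θ_j = k·x_j = (2π/L) ∑_r m_r (x_j)_r`)
one has `|ρ_k(X)|² = N + 2 ∑_{i<j} cos(k·(x_i - x_j))`.

Proof: `‖∑_j e^{iθ_j}‖² = (∑_j cos θ_j)² + (∑_j sin θ_j)²` (real and imaginary parts of
`e^{iθ} = cos θ + i sin θ`), `= ∑_i ∑_j (cos θ_i cos θ_j + sin θ_i sin θ_j) = ∑_i ∑_j cos(θ_i - θ_j)`
(`Real.cos_sub`); the symmetric double sum splits into its diagonal (`N` terms `cos 0 = 1`) and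
twice its upper triangle (the tree lemma `Coulomb.sum_sum_eq_diag_add_two_mul` of
`OnsagerInequality.lean`, imported for this purpose only); finally
`θ_i - θ_j = (2π/L) ∑_r m_r ((x_i)_r - (x_j)_r)` by linearity. Otherwise Mathlib only
(`Complex.sq_norm`, `Complex.normSq_apply`, `Complex.exp_ofReal_mul_I_re/im`, `Finset.sum_mul_sum`).
-/

noncomputable section

namespace Summit.AtomisticToContinuum.BoseEinsteinCondensation.Theorems

open Literature.MathematicalPhysics.QuantumManyBody.BoseGas

/-! ### The modulus square of a sum of phases -/

/-- **Modulus square of a sum of phases.** For real phases `θ₁, …, θ_N`,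
`‖∑_j e^{iθ_j}‖² = N + 2 ∑_{i<j} cos(θ_i - θ_j)`: real and imaginary parts, `Real.cos_sub`, and the
diagonal/upper-triangle split `Coulomb.sum_sum_eq_diag_add_two_mul` of the symmetric double sum
`∑ᵢ ∑ⱼ cos(θ_i - θ_j)`. [folklore] -/
theorem normSqDensityWave_norm_sum_exp_sq {N : ℕ} (θ : Fin N → ℝ) :
    ‖∑ j, Complex.exp (Complex.I * (θ j : ℂ))‖ ^ 2 =
      (N : ℝ) + 2 * ∑ i, ∑ j with i < j, Real.cos (θ i - θ j) := by
  have hre : (∑ j, Complex.exp (Complex.I * (θ j : ℂ))).re = ∑ j, Real.cos (θ j) := by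
    rw [Complex.re_sum]
    refine Finset.sum_congr rfl fun j _ => ?_
    rw [mul_comm, Complex.exp_ofReal_mul_I_re]
  have him : (∑ j, Complex.exp (Complex.I * (θ j : ℂ))).im = ∑ j, Real.sin (θ j) := by
    rw [Complex.im_sum]
    refine Finset.sum_congr rfl fun j _ => ?_
    rw [mul_comm, Complex.exp_ofReal_mul_I_im]
  have h1 : (∑ i, Real.cos (θ i)) ^ 2 + (∑ i, Real.sin (θ i)) ^ 2 =
      ∑ i, ∑ j, Real.cos (θ i - θ j) := by
    rw [sq, sq, Finset.sum_mul_sum, Finset.sum_mul_sum, ← Finset.sum_add_distrib]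
    refine Finset.sum_congr rfl fun i _ => ?_
    rw [← Finset.sum_add_distrib]
    refine Finset.sum_congr rfl fun j _ => ?_
    rw [Real.cos_sub]
  have h2 := Literature.MathematicalPhysics.QuantumManyBody.Coulomb.sum_sum_eq_diag_add_two_mul
    (fun i j => Real.cos (θ i - θ j))
    (fun i j => by rw [← Real.cos_neg, neg_sub])
  simp only [sub_self, Real.cos_zero, Finset.sum_const, Finset.card_univ, Fintype.card_fin,
    nsmul_eq_mul, mul_one] at h2
  rw [Complex.sq_norm, Complex.normSq_apply, hre, him, ← sq, ← sq, h1, h2]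

/-! ### The stub -/

/-- **Stub N — norm square of the density wave.** For every `N`, `L`, `m ∈ ℤ³` and every
configuration `X ∈ (ℝ³)^N`, the density wave `ρ_k(X) = ∑_j e^{i k·x_j}` (`BoseGas.densityWave`,
`k = 2πm/L`, `k·x_j = (2π/L) ∑_r m_r (x_j)_r`) satisfies
`‖ρ_k(X)‖² = N + 2 ∑_{i<j} cos((2π/L) ∑_r m_r ((x_i)_r - (x_j)_r))`: expand the double sum,
diagonal `N`, off-diagonal pairs `2 Re e^{i(θ_i - θ_j)} = 2 cos(θ_i - θ_j)`
(`normSqDensityWave_norm_sum_exp_sq` with `θ_j = (2π/L) ∑_r m_r (x_j)_r`, then linearity of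
`θ_i - θ_j`). No hypothesis on `L` (for `L = 0` both sides are computed with `2π/0 = 0`). [folklore] -/
theorem stub_normSqDensityWave : open MeasureTheory Literature.MathematicalPhysics.QuantumManyBody.BoseGas in ∀ (N : ℕ) (L : ℝ) (m : Fin 3 → ℤ) (X : Fin N → EuclideanSpace ℝ (Fin 3)), ‖densityWave N L m X‖ ^ 2 = (N : ℝ) + 2 * ∑ i : Fin N, ∑ j : Fin N with i < j, Real.cos (2 * Real.pi / L * ∑ r : Fin 3, (m r : ℝ) * (X i r - X j r)) := by
  intro N L m X
  rw [densityWave_eq_sum,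
    normSqDensityWave_norm_sum_exp_sq (fun j => 2 * Real.pi / L * ∑ t : Fin 3, (m t : ℝ) * X j t)]
  refine congrArg (fun s : ℝ => (N : ℝ) + 2 * s)
    (Finset.sum_congr rfl fun i _ => Finset.sum_congr rfl fun j _ => congrArg Real.cos ?_)
  rw [Finset.mul_sum, Finset.mul_sum, Finset.mul_sum, ← Finset.sum_sub_distrib]
  exact Finset.sum_congr rfl fun r _ => by ring

end Summit.AtomisticToContinuum.BoseEinsteinCondensation.Theorems

end
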